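import Mathlib
import HarnessLib

/-!
# Route `KLProgramme` — crux K3 `KLRegimeTwoPointLimit` (stmt-HubbardSuperconductivity-19937), support:
# real-variable counting tools for the intersection count of Lemmas E.1 / E.3 (DECOMP App. E)

Cell `gate-hubbard-kl`, seat p1b (C1 second hand); paper note `HOME/prover-p1b/E1-NOTE.md` §3 Lemma 7.

The sharp exponent of the two-shell (one-loop volume) bound needs a UNIFORM bound on the number of
torus intersection points of the band Fermi curve `F_μ` with its translate `F_μ + w`, i.e. on the
number of zeros of the translated level function `G_w` in a period. E1-NOTE Lemma 7 obtains it from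
three elementary real-variable mechanisms, proved here in abstract form:

* `klsk_finite_ncard_le_of_separated` — an `ℓ`-separated subset of `[x, y]` is finite with at most
  `(y - x)/ℓ + 1` points (inject `z ↦ ⌊(z - x)/ℓ⌋₊` into `{0, …, ⌊(y - x)/ℓ⌋₊}`);
* `klsk_exists_critical_between` — between two zeros of `g` there is a critical point `c` with
  `|g c| ≤ M·(gap)` (`M` a bound on `|g'|`: Rolle + the mean value inequality); hence
  `klsk_zeros_finite_ncard_le`: if no critical point `c ∈ [x, y]` has `|g c| ≤ M ℓ` ("no bad point
  in the interval"), the zeros of `g` in `[x, y]` are `ℓ`-separated, so there are `≤ (y - x)/ℓ + 1`;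
* `klsk_zeros_subset_pair_of_strictMonoOn_deriv` — if `g'` is strictly increasing on `[x, y]`
  (e.g. `g'' > 0`, the caustic window), `g` has at most two zeros there (Rolle twice).

Pure Mathlib; used by the seat's count file for `G_w` (uniformly transversal zeros off the caustic
windows are separated; at most two zeros inside each window).
-/

noncomputable section

-- the tree's namespace `Summit.<Summit>.<Problem>.Theorems` repeats the summit name by design (D-0017)
set_option linter.dupNamespace false

open Real Set

namespace Summit.HubbardSuperconductivity.HubbardSuperconductivity.Theorems

/-! ### Separated subsets of an interval -/

/-- An `ℓ`-separated subset of `[x, y]` (`x ≤ y`, `ℓ > 0`) is finite and has at most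
`(y - x)/ℓ + 1` elements. -/
theorem klsk_finite_ncard_le_of_separated {S : Set ℝ} {x y ℓ : ℝ} (hℓ : 0 < ℓ) (hxy : x ≤ y)
    (hS : S ⊆ Icc x y) (hsep : ∀ z ∈ S, ∀ z' ∈ S, z < z' → ℓ ≤ z' - z) :
    S.Finite ∧ (S.ncard : ℝ) ≤ (y - x) / ℓ + 1 := by
  classical
  set N := ⌊(y - x) / ℓ⌋₊ with hN
  set f : ℝ → ℕ := fun z => ⌊(z - x) / ℓ⌋₊ with hf
  set T : Set ℕ := ↑(Finset.range (N + 1)) with hT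
  have hTfin : T.Finite := (Finset.range (N + 1)).finite_toSet
  have hmaps : ∀ z ∈ S, f z ∈ T := by
    intro z hz
    have hzI := hS hz
    rw [hT, Finset.coe_range, Set.mem_Iio, Nat.lt_add_one_iff, hf, hN]
    exact Nat.floor_le_floor (div_le_div_of_nonneg_right (by linarith [hzI.2]) hℓ.le)
  have hinj : InjOn f S := by
    intro z hz z' hz' hzz'
    by_contra hne
    -- two distinct points with the same floor are `< ℓ` apart: contradiction with separation
    have key : ∀ u ∈ S, ∀ u' ∈ S, u < u' → f u = f u' → False := by
      intro u hu u' hu' huu' hff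
      have hsep' := hsep u hu u' hu' huu'
      have hu0 : 0 ≤ (u - x) / ℓ := div_nonneg (by linarith [(hS hu).1]) hℓ.le
      have hstep : (u - x) / ℓ + 1 ≤ (u' - x) / ℓ := by
        rw [div_add_one hℓ.ne', div_le_div_iff_of_pos_right hℓ]; linarith
      have h1 : ⌊(u - x) / ℓ + 1⌋₊ ≤ ⌊(u' - x) / ℓ⌋₊ := Nat.floor_le_floor hstep
      rw [Nat.floor_add_one hu0] at h1
      have h2 : f u' = ⌊(u' - x) / ℓ⌋₊ := rfl
      have h3 : f u = ⌊(u - x) / ℓ⌋₊ := rfl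
      omega
    rcases lt_or_gt_of_ne hne with h | h
    · exact key z hz z' hz' h hzz'
    · exact key z' hz' z hz h hzz'.symm
  have hfin : S.Finite := Set.Finite.of_finite_image (hTfin.subset (fun n ⟨z, hz, hzn⟩ => hzn ▸ hmaps z hz)) hinj
  refine ⟨hfin, ?_⟩
  have hcard : S.ncard ≤ T.ncard := Set.ncard_le_ncard_of_injOn f hmaps hinj hTfin
  rw [hT, Set.ncard_coe_finset, Finset.card_range] at hcard
  calc (S.ncard : ℝ) ≤ ((N + 1 : ℕ) : ℝ) := by exact_mod_cast hcard
    _ = (N : ℝ) + 1 := by push_cast; ring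
    _ ≤ (y - x) / ℓ + 1 := by
        rw [hN]; gcongr; exact Nat.floor_le (div_nonneg (by linarith) hℓ.le)

/-! ### A critical point between two zeros -/

/-- Between two zeros `z < z'` of a differentiable `g` with `|g'| ≤ M` there is a critical point
`c ∈ (z, z')` with `|g c| ≤ M (z' - z)` (Rolle's theorem and the mean value inequality). -/
theorem klsk_exists_critical_between {g g' : ℝ → ℝ} (hg : ∀ t, HasDerivAt g (g' t) t)
    {M z z' : ℝ} (hM : ∀ t, |g' t| ≤ M) (hzz' : z < z') (hz : g z = 0) (hz' : g z' = 0) :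
    ∃ c ∈ Ioo z z', g' c = 0 ∧ |g c| ≤ M * (z' - z) := by
  have hcont : Continuous g := continuous_iff_continuousAt.2 fun t => (hg t).continuousAt
  obtain ⟨c, hc, hc0⟩ := exists_hasDerivAt_eq_zero hzz' hcont.continuousOn (hz.trans hz'.symm)
    (fun t _ => hg t)
  refine ⟨c, hc, hc0, ?_⟩
  have hlip := (convex_univ (𝕜 := ℝ) (E := ℝ)).norm_image_sub_le_of_norm_hasDerivWithin_le
    (f := g) (f' := g') (fun t _ => (hg t).hasDerivWithinAt)
    (fun t _ => by rw [Real.norm_eq_abs]; exact hM t) (mem_univ z) (mem_univ c)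
  rw [Real.norm_eq_abs, Real.norm_eq_abs, hz, sub_zero, abs_of_pos (by linarith [hc.1] : 0 < c - z)] at hlip
  have hM0 : 0 ≤ M := (abs_nonneg _).trans (hM z)
  calc |g c| ≤ M * (c - z) := hlip
    _ ≤ M * (z' - z) := mul_le_mul_of_nonneg_left (by linarith [hc.2]) hM0

/-- **Separated zeros.** If `|g'| ≤ M` and no critical point `c ∈ [x, y]` of `g` has
`|g c| ≤ M ℓ` (every "bad" point lies outside the interval), then any two zeros of `g` in `[x, y]`
are `≥ ℓ` apart; hence the zero set of `g` in `[x, y]` is finite with at most `(y - x)/ℓ + 1`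
elements. -/
theorem klsk_zeros_finite_ncard_le {g g' : ℝ → ℝ} (hg : ∀ t, HasDerivAt g (g' t) t)
    {x y ℓ M : ℝ} (hℓ : 0 < ℓ) (hxy : x ≤ y) (hM : ∀ t, |g' t| ≤ M)
    (hbad : ∀ c ∈ Icc x y, g' c = 0 → |g c| ≤ M * ℓ → False) :
    {z ∈ Icc x y | g z = 0}.Finite ∧ (({z ∈ Icc x y | g z = 0}).ncard : ℝ) ≤ (y - x) / ℓ + 1 := by
  refine klsk_finite_ncard_le_of_separated hℓ hxy (fun z hz => hz.1) ?_
  intro z hz z' hz' hzz'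
  by_contra hlt
  push Not at hlt
  obtain ⟨c, hc, hc0, hgc⟩ := klsk_exists_critical_between hg hM hzz' hz.2 hz'.2
  have hcI : c ∈ Icc x y := ⟨le_trans hz.1.1 hc.1.le, le_trans hc.2.le hz'.1.2⟩
  have hM0 : 0 ≤ M := (abs_nonneg _).trans (hM z)
  exact hbad c hcI hc0 (hgc.trans (mul_le_mul_of_nonneg_left hlt.le hM0))

/-! ### At most two zeros when the slope is strictly increasing -/

/-- Three ordered zeros are impossible when `g'` is strictly increasing on `[x, y]`. -/
theorem klsk_no_three_zeros_of_strictMonoOn_deriv {g g' : ℝ → ℝ} (hg : ∀ t, HasDerivAt g (g' t) t)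
    {x y : ℝ} (hmono : StrictMonoOn g' (Icc x y)) {z₁ z₂ z₃ : ℝ}
    (h₁ : z₁ ∈ Icc x y) (h₃ : z₃ ∈ Icc x y) (h12 : z₁ < z₂) (h23 : z₂ < z₃)
    (hg₁ : g z₁ = 0) (hg₂ : g z₂ = 0) (hg₃ : g z₃ = 0) : False := by
  have hcont : Continuous g := continuous_iff_continuousAt.2 fun t => (hg t).continuousAt
  obtain ⟨c₁, hc₁, hc₁0⟩ := exists_hasDerivAt_eq_zero h12 hcont.continuousOn (hg₁.trans hg₂.symm)
    (fun t _ => hg t)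
  obtain ⟨c₂, hc₂, hc₂0⟩ := exists_hasDerivAt_eq_zero h23 hcont.continuousOn (hg₂.trans hg₃.symm)
    (fun t _ => hg t)
  have hc₁I : c₁ ∈ Icc x y := ⟨le_trans h₁.1 hc₁.1.le, by linarith [hc₁.2, h₃.2]⟩
  have hc₂I : c₂ ∈ Icc x y := ⟨by linarith [hc₂.1, h₁.1], le_trans hc₂.2.le h₃.2⟩
  have hlt : c₁ < c₂ := hc₁.2.trans hc₂.1
  have := hmono hc₁I hc₂I hlt
  rw [hc₁0, hc₂0] at this
  exact lt_irrefl _ this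

/-- **At most two zeros.** If `g'` is strictly increasing on `[x, y]` (e.g. `g'' > 0` there), the
zeros of `g` in `[x, y]` lie in a set of at most two points. -/
theorem klsk_zeros_subset_pair_of_strictMonoOn_deriv {g g' : ℝ → ℝ} (hg : ∀ t, HasDerivAt g (g' t) t)
    {x y : ℝ} (hmono : StrictMonoOn g' (Icc x y)) :
    ∃ Z : Finset ℝ, Z.card ≤ 2 ∧ ∀ z ∈ Icc x y, g z = 0 → z ∈ Z := by
  classical
  by_cases hex : ∃ z₁ ∈ Icc x y, g z₁ = 0
  · obtain ⟨z₁, hz₁, hg₁⟩ := hex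
    by_cases hex2 : ∃ z₂ ∈ Icc x y, g z₂ = 0 ∧ z₂ ≠ z₁
    · obtain ⟨z₂, hz₂, hg₂, hne⟩ := hex2
      -- order the two zeros
      obtain ⟨a, c, ha, hc, hga, hgc, hac, hset⟩ : ∃ a c : ℝ, a ∈ Icc x y ∧ c ∈ Icc x y ∧
          g a = 0 ∧ g c = 0 ∧ a < c ∧ ({z₁, z₂} : Finset ℝ) = {a, c} := by
        rcases lt_or_gt_of_ne hne with h | h
        · exact ⟨z₂, z₁, hz₂, hz₁, hg₂, hg₁, h, Finset.pair_comm _ _⟩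
        · exact ⟨z₁, z₂, hz₁, hz₂, hg₁, hg₂, h, rfl⟩
      refine ⟨{a, c}, (Finset.card_insert_le _ _).trans (by simp), ?_⟩
      intro z hz hgz
      by_contra hzm
      have hza : z ≠ a := fun h => hzm (by simp [h])
      have hzc : z ≠ c := fun h => hzm (by simp [h])
      rcases lt_or_gt_of_ne hza with hlt | hgt
      · exact klsk_no_three_zeros_of_strictMonoOn_deriv hg hmono hz hc hlt hac hgz hga hgc
      · rcases lt_or_gt_of_ne hzc with hlt' | hgt'
        · exact klsk_no_three_zeros_of_strictMonoOn_deriv hg hmono ha hc hgt hlt' hga hgz hgc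
        · exact klsk_no_three_zeros_of_strictMonoOn_deriv hg hmono ha hz hac hgt' hga hgc hgz
    · push Not at hex2
      refine ⟨{z₁}, by simp, ?_⟩
      intro z hz hgz
      rw [Finset.mem_singleton]
      exact hex2 z hz hgz
  · push Not at hex
    exact ⟨∅, by simp, fun z hz hgz => (hex z hz hgz).elim⟩

end Summit.HubbardSuperconductivity.HubbardSuperconductivity.Theorems

end
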